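import Summits.MatrixMultiplication.OmegaCensus.STPPCell22Checker
import Summits.MatrixMultiplication.OmegaCensus.STPPVosperSlackTwoCheckersSound
import Summits.MatrixMultiplication.OmegaCensus.STPPVosperCoverSearch

/-!
# ω-census (abelian STPP census): cell-(2,2) certificate soundness, part 1 — the exact-cover test `coverK` is complete (tool file)

HONEST FRAMING (pub-omega census; verbatim): lottery ticket; floor = certified bounds/negative ranges.
Census STRUCTURE (seat pub-omega-stpp-1 gen 33, 2026-08-29), family (b2).  First mask-level lemma of the law that will consume the cell-(2,2) rows
(`STPPCell22Checker.lean`, plan in HOME `pub-omega-stpp-1-g33/FIFTH-LEAF.md` §SOUNDNESS, step S7): if `W` is a disjoint union of `k` translates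
`X + c` (`c ∈ cs`) of a nonempty pattern `X ⊆ [0,p)`, then the greedy exact-cover test `coverK p X (members (List.range p) X) k W` returns `true`
(`coverK_complete`, hypotheses inlined — no `Prop` definitions); with the spec of `lowMem` and one piece of modular index arithmetic (the other is the tree's `CubeNB.sub_mod_sub_mod_eq`).  UNCONDITIONAL; no `decide`.  Nothing here is progress on `ω`.

References: H. S. Warren, Hacker's Delight (2002), §2-1 (bit sets); H. Cohn, R. Kleinberg, B. Szegedy, C. Umans, FOCS 2005, Def. 5.1 (the use).
-/

namespace Summit.MatrixMultiplication.OmegaCensus.CubeNB.S2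

open Summit.MatrixMultiplication.OmegaCensus.CubeNB.Bits

/-! ## §1 Small facts -/

/-- **Spec of `lowMem`**: if `W` has a member below `p`, `lowMem p W` is a member below `p`. [folklore] -/
theorem tb_lowMem {p W v : ℕ} (hv : v < p) (h : tb W v = true) : tb W (lowMem p W) = true ∧ lowMem p W < p := by
  unfold lowMem
  cases hf : (List.range p).find? (fun u => tb W u) with
  | none =>
    have := (List.find?_eq_none.1 hf) v (List.mem_range.2 hv)
    exact absurd h (by simpa using this)
  | some a =>
    have h1 := List.find?_some hf
    have h2 := List.mem_of_find?_eq_some hf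
    rw [List.mem_range] at h2
    exact ⟨by simpa using h1, by simpa using h2⟩

/-- A mask with a set bit is nonzero. [folklore] -/
theorem ne_zero_of_tb {W v : ℕ} (h : tb W v = true) : W ≠ 0 := by
  rintro rfl
  rw [tb_zero] at h
  exact Bool.false_ne_true h

/-- A mask with no set bit is zero. [folklore] -/
theorem eq_zero_of_tb {W : ℕ} (h : ∀ v, tb W v = false) : W = 0 :=
  Nat.zero_of_testBit_eq_false fun i => by rw [← tb_eq_testBit]; exact h i

/-- Index arithmetic: `((x + c) mod p − c) mod p = x`. [folklore] -/
theorem mod_add_sub_cancel {p x c : ℕ} (hx : x < p) (hc : c ≤ p) : ((x + c) % p + p - c) % p = x := by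
  rcases Nat.lt_or_ge (x + c) p with h | h
  · rw [Nat.mod_eq_of_lt h, show x + c + p - c = x + p by omega, Nat.add_mod_right, Nat.mod_eq_of_lt hx]
  · rw [Nat.mod_eq_sub_mod h, Nat.mod_eq_of_lt (show x + c - p < p by omega), show x + c - p + p - c = x by omega, Nat.mod_eq_of_lt hx]

/-! ## §2 Disjoint unions of translates and the completeness of `coverK` -/

/-- Removing one translate from a disjoint union of translates: the membership description of `W ^^^ (X + c)`. [folklore] -/
theorem tb_xor_rot_iff_of_transUnion {p X W : ℕ} {cs : List ℕ} (hnd : cs.Nodup)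
    (hiff : ∀ v, tb W v = true ↔ v < p ∧ ∃ c ∈ cs, tb (rot p X c) v = true)
    (hdisj : ∀ c₁ ∈ cs, ∀ c₂ ∈ cs, c₁ ≠ c₂ → ∀ v, ¬(tb (rot p X c₁) v = true ∧ tb (rot p X c₂) v = true)) {c : ℕ} (hc : c ∈ cs) :
    ∀ v, tb (W ^^^ rot p X c) v = true ↔ v < p ∧ ∃ c' ∈ cs.erase c, tb (rot p X c') v = true := by
  intro v
  rw [tb_xor]
  constructor
  · intro hv
    cases hW : tb W v <;> cases hm : tb (rot p X c) v <;> rw [hW, hm] at hv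
    · exact absurd hv (by decide)
    · -- `tb W v = false`, `tb m v = true`: impossible, the translate lies inside `W`
      exfalso
      have hvp : v < p := by
        by_contra hvp
        rw [tb_eq_false_of_lt (rot_lt_two_pow p X c) (not_lt.1 hvp)] at hm
        exact Bool.false_ne_true hm
      have := (hiff v).2 ⟨hvp, c, hc, hm⟩
      rw [hW] at this
      exact Bool.false_ne_true this
    · obtain ⟨hvp, c', hc', hc'v⟩ := (hiff v).1 hW
      have hne : c' ≠ c := by rintro rfl; rw [hm] at hc'v; exact Bool.false_ne_true hc'v
      exact ⟨hvp, c', (hnd.mem_erase_iff).2 ⟨hne, hc'⟩, hc'v⟩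
    · exact absurd hv (by decide)
  · rintro ⟨hvp, c', hc', hc'v⟩
    obtain ⟨hne, hc'cs⟩ := (hnd.mem_erase_iff).1 hc'
    have hW : tb W v = true := (hiff v).2 ⟨hvp, c', hc'cs, hc'v⟩
    have hm : tb (rot p X c) v = false := by
      rw [Bool.eq_false_iff]
      exact fun hm => hdisj c' hc'cs c hc hne v ⟨hc'v, hm⟩
    rw [hW, hm]; rfl

/-- **Completeness of the greedy exact-cover test.**  If `W ⊆ [0,p)` is the disjoint union of the `k` translates `X + c`, `c ∈ cs` (`cs` duplicate-free,
below `p`), of the nonempty pattern `X ⊆ [0,p)`, then `coverK p X (members (List.range p) X) k W = true`. [folklore] -/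
theorem coverK_complete {p X : ℕ} (hX : X < 2 ^ p) (hX0 : ∃ x < p, tb X x = true) :
    ∀ (k : ℕ) (cs : List ℕ) (W : ℕ), cs.length = k → (∀ c ∈ cs, c < p) → cs.Nodup →
      (∀ v, tb W v = true ↔ v < p ∧ ∃ c ∈ cs, tb (rot p X c) v = true) →
      (∀ c₁ ∈ cs, ∀ c₂ ∈ cs, c₁ ≠ c₂ → ∀ v, ¬(tb (rot p X c₁) v = true ∧ tb (rot p X c₂) v = true)) →
      coverK p X (members (List.range p) X) k W = true := by
  intro k
  induction k with
  | zero =>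
    intro cs W hlen _ _ hiff _
    obtain rfl := List.length_eq_zero_iff.1 hlen
    have hW : W = 0 := eq_zero_of_tb fun v => by
      rw [Bool.eq_false_iff]
      intro hv
      obtain ⟨-, c, hc, -⟩ := (hiff v).1 hv
      exact List.not_mem_nil hc
    subst hW
    rfl
  | succ k ih =>
    intro cs W hlen hlt hnd hiff hdisj
    obtain ⟨x, hxp, hx⟩ := hX0
    -- `cs` is nonempty, so `W` has a member below `p`
    obtain ⟨c₀, hc₀⟩ : ∃ c₀, c₀ ∈ cs := by
      rcases cs with _ | ⟨c₀, _⟩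
      · exact absurd hlen (by simp)
      · exact ⟨c₀, List.mem_cons_self⟩
    have hc₀p := hlt c₀ hc₀
    have hmem : tb W ((x + c₀) % p) = true := by
      refine (hiff _).2 ⟨Nat.mod_lt _ (by omega), c₀, hc₀, ?_⟩
      rw [tb_rot hX hc₀p.le (Nat.mod_lt _ (by omega)), mod_add_sub_cancel hxp hc₀p.le, hx]
    obtain ⟨hlow, hlowp⟩ := tb_lowMem (Nat.mod_lt _ (by omega)) hmem
    set l := lowMem p W with hl
    -- the translate containing the least member
    obtain ⟨-, c, hc, hcl⟩ := (hiff l).1 hlow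
    have hcp := hlt c hc
    rw [tb_rot hX hcp.le hlowp] at hcl
    set x₁ := (l + p - c) % p with hx₁
    have hx₁p : x₁ < p := Nat.mod_lt _ (by omega)
    have hx₁mem : x₁ ∈ members (List.range p) X := mem_members.2 ⟨List.mem_range.2 hx₁p, hcl⟩
    have hidx : (l + p - x₁) % p = c := by rw [hx₁]; exact CubeNB.sub_mod_sub_mod_eq hlowp hcp
    -- unfold one step of `coverK`
    show (!(Nat.beq W 0) && (members (List.range p) X).any fun x =>
      (Nat.beq (rot p X ((lowMem p W + p - x) % p) &&& (fullMask p ^^^ W)) 0 &&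
        coverK p X (members (List.range p) X) k (W ^^^ rot p X ((lowMem p W + p - x) % p)))) = true
    rw [Bool.and_eq_true]
    constructor
    · have hW0 : W ≠ 0 := ne_zero_of_tb hlow
      cases hb : Nat.beq W 0
      · rfl
      · exact absurd (Nat.eq_of_beq_eq_true hb) hW0
    · rw [List.any_eq_true]
      refine ⟨x₁, hx₁mem, ?_⟩
      rw [← hl, hidx, Bool.and_eq_true]
      constructor
      · -- the translate `X + c` lies inside `W`
        have h0 : rot p X c &&& (fullMask p ^^^ W) = 0 := eq_zero_of_tb fun v => by
          rw [tb_land, Bool.eq_false_iff]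
          intro hv
          rw [Bool.and_eq_true] at hv
          rcases Nat.lt_or_ge v p with hvp | hvp
          · have hWv : tb W v = true := (hiff v).2 ⟨hvp, c, hc, hv.1⟩
            rw [tb_compl hvp, hWv] at hv
            exact absurd hv.2 (by decide)
          · rw [tb_eq_false_of_lt (rot_lt_two_pow p X c) hvp] at hv
            exact Bool.false_ne_true hv.1
        rw [h0]; rfl
      · -- the rest is the disjoint union of the other `k` translates
        refine ih (cs.erase c) _ ?_ (fun c' hc' => hlt c' (List.mem_of_mem_erase hc')) (hnd.erase c)
          (tb_xor_rot_iff_of_transUnion hnd hiff hdisj hc)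
          (fun c₁ hc₁ c₂ hc₂ hne => hdisj c₁ (List.mem_of_mem_erase hc₁) c₂ (List.mem_of_mem_erase hc₂) hne)
        rw [List.length_erase_of_mem hc, hlen]; rfl

end Summit.MatrixMultiplication.OmegaCensus.CubeNB.S2
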